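import Summits.RiemannHypothesis.RiemannHypothesis.Theorems.NymanBeurlingVasyunin
import Summits.RiemannHypothesis.RiemannHypothesis.Theorems.NymanBeurlingGramRhs
import Summits.RiemannHypothesis.RiemannHypothesis.Theorems.NymanBeurlingKappaZerothOrder
import Summits.RiemannHypothesis.RiemannHypothesis.Theorems.LiKernelTableCorollaries
import Literature.Analysis.ValidatedNumerics.MultiPrecisionInterval
import HarnessLib

/-!
# RiemannHypothesis / Nyman–Beurling — KERNEL LINEAGE K, part 1: the Gram matrix and right-hand side of the
Báez-Duarte problem EVALUATED INSIDE THE KERNEL (interval enclosures of `G_{jk}` and `b_k`)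

Column LI/NB of the RH ladder, rung L-D (b) «certified `d_N²` and minimisers `c⋆_N`, two lineages» → L-P(P2),
PROOF-OF-DATA for cell `pub/rh-li` [rh-li-eng-3].  The DATA rung's lineages A/A6 (Arb), R (exact integer limbs,
kit j249067) and C2 (float) all evaluate the Gram matrix from Vasyunin's cotangent formula — which is the tree theorem
`nbGram_eq_vasyunin` (file `NymanBeurlingVasyunin.lean`).  This file makes the KERNEL a further lineage: computable
interval programs over the tree's multi-precision engine `Literature.Analysis.ValidatedNumerics.NumericsMP.MI`
(integer end points at a scale `S`), each with its inclusion theorem —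

* `gammaI S ∋ γ` (`mem_gammaI`, from the kernel-certified 47-digit enclosure
  `LiKernel.eulerMascheroniConstant_gt_d49 / lt_d47`);
* `cisEncl ∋ e^{iπr/q}` (Taylor at `πr/(q 2^KSQ)` then `KSQ` squarings; `mem_cisEncl`), `cotEncl ∋ cot(πr/q)`
  (`mem_cotEncl`), the table `cotTable` (`oget_cotTable`);
* `vasyEncl ∋ V(p,q) = Σ_{r<q} {rp/q} cot(πr/q)` (`mem_vasyEncl`);
* `l2pigEncl ∋ log 2π − γ` (`mem_l2pigEncl`), `gramEncl j k ∋ nbGram j k` (`mem_gramEncl`, via `nbGram_eq_vasyunin`),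
  `rhsEncl k ∋ nbRhs k` (`mem_rhsEncl`, via `nbRhs_eq`), and the tables `logTable`, `gramTable` (upper triangle,
  read through `gget`, `mem_gget`), `rhsTable` (`mem_rget`).

Parts 2–3 (`NymanBeurlingKernelCertificate*.lean`) check a Cholesky/Gershgorin form bound and per-`N` residual certificates
against these enclosures; part 4 (`NymanBeurlingKernelTable.lean`) runs everything for `N ≤ 32` by `decide +kernel`.
RH-FREE: interval arithmetic on classical constants; nothing here bears on `d_N → 0` or on the truth of RH. -/

-- D-0017: `Summit.<S>.<S>.…` is the designed namespace of a single-problem summit.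
set_option linter.dupNamespace false

namespace Summit.RiemannHypothesis.RiemannHypothesis.Theorems.NbTheory

open Literature.NumberTheory.LFunctions
open Literature.Analysis.ValidatedNumerics Literature.Analysis.ValidatedNumerics.NumericsMP
open Finset

namespace NbKernel

/-! ## Euler's constant -/
/-- Numerator of the kernel-certified lower bound `γ > 0.5772…9399` (49 decimals, `LiKernelTableCorollaries`). -/
def gammaLoN : ℤ := 5772156649015328606065120900824024310421593359399
/-- Numerator of the kernel-certified upper bound `γ < 0.5772…3594` (47 decimals). -/
def gammaHiN : ℤ := 57721566490153286060651209008240243104215933594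

/-- `gammaI S ∋ γ`: the two decimal bounds rounded outward to scale `S`. -/
def gammaI (S : ℕ) : MI := MI.span (MI.ofFrac S gammaLoN (10 ^ 49)) (MI.ofFrac S gammaHiN (10 ^ 47))

/-- `γ ∈ gammaI S`. -/
theorem mem_gammaI (S : ℕ) : MI.mem S Real.eulerMascheroniConstant (gammaI S) := by
  refine MI.mem_span (MI.mem_ofFrac S gammaLoN (q := 10 ^ 49) (by positivity))
    (MI.mem_ofFrac S gammaHiN (q := 10 ^ 47) (by positivity)) ?_ ?_
  · have h := LiKernel.eulerMascheroniConstant_gt_d49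
    have e : ((gammaLoN : ℤ) : ℝ) / ((10 ^ 49 : ℕ) : ℝ) =
        (0.5772156649015328606065120900824024310421593359399 : ℝ) := by norm_num [gammaLoN]
    rw [e]; exact h.le
  · have h := LiKernel.eulerMascheroniConstant_lt_d47
    have e : ((gammaHiN : ℤ) : ℝ) / ((10 ^ 47 : ℕ) : ℝ) =
        (0.57721566490153286060651209008240243104215933594 : ℝ) := by norm_num [gammaHiN]
    rw [e]; exact h.le

/-! ## `e^{iπr/q}` and `cot(πr/q)` -/
/-- Enclosure of `e^{iθ}`, `θ = πr/q`: `KEXP` Taylor terms at `θ/2^KSQ ∈ [-1,1]`, then `KSQ` complex squarings. -/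
def cisEncl (S KEXP KSQ : ℕ) (piI : MI) (r q : ℕ) : Option MC :=
  match MC.expISmallPt S KEXP ((piI.mulInt r).divNat (q * 2 ^ KSQ)) with
  | some A => some (MC.sqrIter S KSQ A)
  | none => none

/-- `e^{iπr/q} ∈ cisEncl`. -/
theorem mem_cisEncl {S KEXP KSQ : ℕ} (hS : 0 < S) {piI : MI} (hpi : MI.mem S Real.pi piI) {r q : ℕ}
    (hq : 0 < q) {A : MC} (h : cisEncl S KEXP KSQ piI r q = some A) :
    MC.mem S (Complex.exp ((((r : ℝ) * Real.pi / q : ℝ) : ℂ) * Complex.I)) A := by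
  unfold cisEncl at h
  split at h
  · rename_i B hB
    simp only [Option.some.injEq] at h
    subst h
    set φ : ℝ := Real.pi * r / ((q * 2 ^ KSQ : ℕ) : ℝ) with hφ
    have hφmem : MI.mem S φ ((piI.mulInt r).divNat (q * 2 ^ KSQ)) := by
      have := MI.mem_divNat (MI.mem_mulInt hpi (r : ℤ)) (n := q * 2 ^ KSQ) (by positivity)
      simpa [hφ] using this
    have h1 := MC.mem_expISmallPt hS hB hφmem
    have h2 := MC.mem_sqrIter hS KSQ h1
    convert h2 using 2
    rw [← Complex.exp_nsmul, nsmul_eq_mul]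
    congr 1
    rw [hφ]
    push_cast
    field_simp
  · simp at h

/-- Enclosure of `cot(πr/q) = cos/sin` (`none` unless the sine enclosure is positive, i.e. `0 < r < q`). -/
def cotEncl (S KEXP KSQ : ℕ) (piI : MI) (r q : ℕ) : Option MI :=
  match cisEncl S KEXP KSQ piI r q with
  | some A => MI.divPos S A.re A.im
  | none => none

/-- `cot(πr/q) ∈ cotEncl` (in the normalisation `Real.cot (r * π / q)` of `vasyuninCotSum`). -/
theorem mem_cotEncl {S KEXP KSQ : ℕ} (hS : 0 < S) {piI : MI} (hpi : MI.mem S Real.pi piI) {r q : ℕ}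
    (hq : 0 < q) {Y : MI} (h : cotEncl S KEXP KSQ piI r q = some Y) :
    MI.mem S (Real.cot ((r : ℝ) * Real.pi / q)) Y := by
  unfold cotEncl at h
  split at h
  · rename_i A hA
    have hc := mem_cisEncl hS hpi hq hA
    have hre : MI.mem S (Real.cos ((r : ℝ) * Real.pi / q)) A.re := by
      have := hc.1; rwa [Complex.exp_ofReal_mul_I_re] at this
    have him : MI.mem S (Real.sin ((r : ℝ) * Real.pi / q)) A.im := by
      have := hc.2; rwa [Complex.exp_ofReal_mul_I_im] at this
    rw [Real.cot_eq_cos_div_sin]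
    exact MI.mem_divPos hS h hre him
  · simp at h

/-- Accessor of a list-of-lists of optional intervals (`none` outside). -/
def oget (T : List (List (Option MI))) (i j : ℕ) : Option MI := (T.getD i []).getD j none

/-- Accessor of a list of optional intervals (`none` outside). -/
def lget (L : List (Option MI)) (i : ℕ) : Option MI := L.getD i none

/-- The table `q ↦ r ↦ cotEncl r q`, `q, r ≤ M` (materialised once for the kernel). -/
def cotTable (S KEXP KSQ M : ℕ) (piI : MI) : List (List (Option MI)) :=
  (List.range (M + 1)).map fun q ↦ (List.range (M + 1)).map fun r ↦ cotEncl S KEXP KSQ piI r q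

/-- Reading the cotangent table. -/
theorem oget_cotTable {S KEXP KSQ M : ℕ} {piI : MI} {q r : ℕ} (hq : q ≤ M) (hr : r ≤ M) :
    oget (cotTable S KEXP KSQ M piI) q r = cotEncl S KEXP KSQ piI r q := by
  simp only [oget, cotTable, List.getD_eq_getElem?_getD, List.getElem?_map, List.getElem?_range (show q < M + 1 by omega),
    List.getElem?_range (show r < M + 1 by omega), Option.map_some, Option.getD_some]

/-- A valid cotangent table: every present entry `0 < r < q ≤ M` encloses `cot(πr/q)`. -/
theorem mem_oget_cotTable {S KEXP KSQ M : ℕ} (hS : 0 < S) {piI : MI} (hpi : MI.mem S Real.pi piI) {q : ℕ}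
    (hq : q ≤ M) {r : ℕ} (hr : 0 < r) (hrq : r < q) {c : MI} (hc : oget (cotTable S KEXP KSQ M piI) q r = some c) :
    MI.mem S (Real.cot ((r : ℝ) * Real.pi / q)) c := by
  rw [oget_cotTable hq (by omega)] at hc
  exact mem_cotEncl hS hpi (by omega) hc

/-! ## Vasyunin's cotangent sum `V(p,q)` -/
/-- Accumulate `Σ_{i=r}^{r+n-1} ((i p) mod q)/q · cot(πi/q)` onto `acc` (`none` if a table entry is missing). -/
def vasyGo (T : List (List (Option MI))) (p q : ℕ) : ℕ → ℕ → MI → Option MI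
  | 0, _, acc => some acc
  | n + 1, r, acc =>
    match oget T q r with
    | some c => vasyGo T p q n (r + 1) (acc.add ((c.mulInt ((r * p % q : ℕ) : ℤ)).divNat q))
    | none => none

/-- Enclosure of `V(p,q) = Σ_{r=1}^{q-1} {rp/q} cot(πr/q)`. -/
def vasyEncl (T : List (List (Option MI))) (p q : ℕ) : Option MI := vasyGo T p q (q - 1) 1 ⟨0, 0⟩

/-- Invariant of the accumulation `vasyGo`. -/
theorem mem_vasyGo {S : ℕ} {T : List (List (Option MI))} {p q : ℕ} (hq : 0 < q)
    (hT : ∀ r, 0 < r → r < q → ∀ c, oget T q r = some c → MI.mem S (Real.cot ((r : ℝ) * Real.pi / q)) c) :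
    ∀ (n r : ℕ) (acc : MI) (a : ℝ) (V : MI), MI.mem S a acc → 0 < r → r + n ≤ q →
      vasyGo T p q n r acc = some V →
        MI.mem S (a + ∑ i ∈ Finset.Ico r (r + n),
          Int.fract ((i : ℝ) * (p : ℤ) / q) * Real.cot ((i : ℝ) * Real.pi / q)) V
  | 0, r, acc, a, V, ha, _, _, h => by
    simp only [vasyGo, Option.some.injEq] at h
    subst h; simpa using ha
  | n + 1, r, acc, a, V, ha, hr, hrn, h => by
    simp only [vasyGo] at h
    split at h
    · rename_i c hc
      have hcot := hT r hr (by omega) c hc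
      have e : Int.fract ((r : ℝ) * (p : ℤ) / q) = ((r * p % q : ℕ) : ℝ) / q := by
        rw [Int.cast_natCast, ← Nat.cast_mul, Int.fract_div_natCast_eq_div_natCast_mod]
      have hterm : MI.mem S (Int.fract ((r : ℝ) * (p : ℤ) / q) * Real.cot ((r : ℝ) * Real.pi / q))
          ((c.mulInt ((r * p % q : ℕ) : ℤ)).divNat q) := by
        have := MI.mem_divNat (MI.mem_mulInt hcot ((r * p % q : ℕ) : ℤ)) hq
        rw [e]
        convert this using 2
        simp only [Int.cast_natCast]
        ring
      have ih := mem_vasyGo hq hT n (r + 1) _ _ V (MI.mem_add ha hterm) (by omega) (by omega) h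
      have hsplit : a + ∑ i ∈ Finset.Ico r (r + (n + 1)),
            Int.fract ((i : ℝ) * (p : ℤ) / q) * Real.cot ((i : ℝ) * Real.pi / q) =
          a + Int.fract ((r : ℝ) * (p : ℤ) / q) * Real.cot ((r : ℝ) * Real.pi / q) +
            ∑ i ∈ Finset.Ico (r + 1) (r + 1 + n),
              Int.fract ((i : ℝ) * (p : ℤ) / q) * Real.cot ((i : ℝ) * Real.pi / q) := by
        rw [Finset.sum_eq_sum_Ico_succ_bot (by omega : r < r + (n + 1)),
          show r + (n + 1) = r + 1 + n by omega]
        ring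
      rw [hsplit]; exact ih
    · simp at h

/-- `V(p,q) ∈ vasyEncl`. -/
theorem mem_vasyEncl {S : ℕ} {T : List (List (Option MI))} {p q : ℕ} (hq : 0 < q)
    (hT : ∀ r, 0 < r → r < q → ∀ c, oget T q r = some c → MI.mem S (Real.cot ((r : ℝ) * Real.pi / q)) c)
    {V : MI} (h : vasyEncl T p q = some V) : MI.mem S (vasyuninCotSum (p : ℤ) q) V := by
  have := mem_vasyGo hq hT (q - 1) 1 ⟨0, 0⟩ 0 V (by simp [MI.mem]) one_pos (by omega) h
  rw [zero_add, show 1 + (q - 1) = q by omega] at this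
  simpa [vasyuninCotSum] using this

/-! ## Logarithms, `log 2π − γ`, the Gram entries and the right-hand side -/
/-- The table `n ↦ MI.logNat n`, `n ≤ M`. -/
def logTable (S KLOG M : ℕ) : List (Option MI) := (List.range (M + 1)).map fun n ↦ MI.logNat S KLOG n

/-- Reading the log table. -/
theorem lget_logTable {S KLOG M n : ℕ} (hn : n ≤ M) : lget (logTable S KLOG M) n = MI.logNat S KLOG n := by
  simp only [lget, logTable, List.getD_eq_getElem?_getD, List.getElem?_map, List.getElem?_range (show n < M + 1 by omega),
    Option.map_some, Option.getD_some]

/-- A valid log table: every present entry `n ≤ M` encloses `log n`. -/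
theorem mem_lget_logTable {S KLOG M : ℕ} (hS : 0 < S) {n : ℕ} (hn : n ≤ M) {Y : MI}
    (hY : lget (logTable S KLOG M) n = some Y) : MI.mem S (Real.log n) Y := by
  rw [lget_logTable hn] at hY
  exact MI.mem_logNat hS hY

/-- Enclosure of `log 2π − γ = 3 log 2 + log(1 − (1 − π/4)) − γ`. -/
def l2pigEncl (S KLOG : ℕ) (piI : MI) : Option MI :=
  match MI.logTwo S KLOG, MI.logOneSub S KLOG ((MI.ofInt S 1).sub (piI.divNat 4)) with
  | some L2, some Y => some (((L2.mulInt 3).add Y).sub (gammaI S))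
  | _, _ => none

/-- `log 2π − γ ∈ l2pigEncl`. -/
theorem mem_l2pigEncl {S KLOG : ℕ} (hS : 0 < S) {piI : MI} (hpi : MI.mem S Real.pi piI) {Y : MI}
    (h : l2pigEncl S KLOG piI = some Y) :
    MI.mem S (Real.log (2 * Real.pi) - Real.eulerMascheroniConstant) Y := by
  unfold l2pigEncl at h
  split at h
  · rename_i L2 Z hL2 hZ
    simp only [Option.some.injEq] at h
    subst h
    have hx : MI.mem S (1 - Real.pi / 4) ((MI.ofInt S 1).sub (piI.divNat 4)) := by
      have := MI.mem_sub (MI.mem_ofInt S 1) (MI.mem_divNat hpi (n := 4) (by norm_num))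
      have e1 : (1 : ℝ) - Real.pi / 4 = ((1 : ℤ) : ℝ) - Real.pi / ((4 : ℕ) : ℝ) := by push_cast; ring
      rw [e1]; exact this
    have h1 := MI.mem_logOneSub hS hZ hx
    have h2 := MI.mem_logTwo hS hL2
    have h3 := MI.mem_sub (MI.mem_add (MI.mem_mulInt h2 3) h1) (mem_gammaI S)
    have h4 : Real.log (1 - (1 - Real.pi / 4)) = Real.log Real.pi - 2 * Real.log 2 := by
      rw [show (1 : ℝ) - (1 - Real.pi / 4) = Real.pi / 2 ^ 2 by ring,
        Real.log_div Real.pi_pos.ne' (by positivity), Real.log_pow]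
      push_cast
      ring
    have e : Real.log (2 * Real.pi) - Real.eulerMascheroniConstant =
        Real.log 2 * ((3 : ℤ) : ℝ) + Real.log (1 - (1 - Real.pi / 4)) - Real.eulerMascheroniConstant := by
      rw [Real.log_mul (by norm_num) Real.pi_pos.ne', h4]
      push_cast
      ring
    rw [e]; exact h3
  · simp at h

/-- The algebra between Vasyunin's formula as printed and as evaluated. -/
theorem gram_alg {a b q C V P LJ LK : ℝ} (ha : 0 < a) (hb : 0 < b) (hq : 0 < q) :
    ((1 - a / b) / 2 * (LJ - LK) + (a / b + 1) / 2 * C - P / (2 * q) * V) / a =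
      ((LJ - LK) * (b - 1 - (a - 1)) / (2 * b) + C * ((a - 1) + (b - 1) + 2) / (2 * b) - P * V / (2 * q)) / a := by
  field_simp; ring

/-- Enclosure of `nbGram j k` by Vasyunin's formula (`a = j+1`, `b = k+1`, `p/q = a/b` reduced):
`G_{jk} = [(b−a)(log a − log b)/(2b) + (a+b)(log 2π − γ)/(2b) − π (V(p,q)+V(q,p))/(2q)] / a`. -/
def gramEncl (S : ℕ) (T : List (List (Option MI))) (L : List (Option MI)) (c0 piI : MI) (j k : ℕ) :
    Option MI :=
  match lget L (j + 1), lget L (k + 1), vasyEncl T ((j + 1) / Nat.gcd (j + 1) (k + 1)) ((k + 1) / Nat.gcd (j + 1) (k + 1)),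
    vasyEncl T ((k + 1) / Nat.gcd (j + 1) (k + 1)) ((j + 1) / Nat.gcd (j + 1) (k + 1)) with
  | some LA, some LB, some V1, some V2 =>
      some ((((((LA.sub LB).mulInt ((k : ℤ) - j)).divNat (2 * (k + 1))).add
          ((c0.mulInt ((j : ℤ) + k + 2)).divNat (2 * (k + 1)))).sub
          ((piI.mul S (V1.add V2)).divNat (2 * ((k + 1) / Nat.gcd (j + 1) (k + 1))))).divNat (j + 1))
  | _, _, _, _ => none

/-- `nbGram j k ∈ gramEncl j k` (the kernel evaluates the right-hand side of `nbGram_eq_vasyunin`). -/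
theorem mem_gramEncl {S M : ℕ} (hS : 0 < S) {T : List (List (Option MI))} {L : List (Option MI)}
    {c0 piI : MI}
    (hT : ∀ q, q ≤ M → ∀ r, 0 < r → r < q → ∀ c, oget T q r = some c → MI.mem S (Real.cot ((r : ℝ) * Real.pi / q)) c)
    (hL : ∀ n, n ≤ M → ∀ Y, lget L n = some Y → MI.mem S (Real.log n) Y)
    (hc0 : MI.mem S (Real.log (2 * Real.pi) - Real.eulerMascheroniConstant) c0) (hpi : MI.mem S Real.pi piI)
    {j k : ℕ} (hj : j < M) (hk : k < M) {Y : MI} (h : gramEncl S T L c0 piI j k = some Y) :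
    MI.mem S (nbGram j k) Y := by
  unfold gramEncl at h
  split at h
  · rename_i LA LB V1 V2 hLA hLB hV1 hV2
    simp only [Option.some.injEq] at h
    subst h
    set g := Nat.gcd (j + 1) (k + 1) with hg
    set p := (j + 1) / g with hp
    set q := (k + 1) / g with hq
    have hg0 : 0 < g := Nat.gcd_pos_of_pos_left _ (Nat.succ_pos j)
    have hp0 : 0 < p := Nat.div_pos (Nat.gcd_le_left _ (Nat.succ_pos j)) hg0
    have hq0 : 0 < q := Nat.div_pos (Nat.gcd_le_right _ (Nat.succ_pos k)) hg0
    have hpM : p ≤ M := le_trans (Nat.div_le_self _ _) (by omega)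
    have hqM : q ≤ M := le_trans (Nat.div_le_self _ _) (by omega)
    have mA := hL (j + 1) (by omega) LA hLA
    have mB := hL (k + 1) (by omega) LB hLB
    have mV1 := mem_vasyEncl hq0 (hT q hqM) hV1
    have mV2 := mem_vasyEncl hp0 (hT p hpM) hV2
    have m1 := MI.mem_divNat (MI.mem_mulInt (MI.mem_sub mA mB) ((k : ℤ) - j)) (n := 2 * (k + 1)) (by positivity)
    have m2 := MI.mem_divNat (MI.mem_mulInt hc0 ((j : ℤ) + k + 2)) (n := 2 * (k + 1)) (by positivity)
    have m3 := MI.mem_divNat (MI.mem_mul hS hpi (MI.mem_add mV1 mV2)) (n := 2 * q) (by positivity)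
    have m4 := MI.mem_divNat (MI.mem_sub (MI.mem_add m1 m2) m3) (n := j + 1) (Nat.succ_pos j)
    have ha : (0 : ℝ) < (j : ℝ) + 1 := by positivity
    have hb : (0 : ℝ) < (k : ℝ) + 1 := by positivity
    have hq' : (0 : ℝ) < (q : ℝ) := by exact_mod_cast hq0
    have halg := gram_alg (C := Real.log (2 * Real.pi) - Real.eulerMascheroniConstant)
      (V := vasyuninCotSum (p : ℤ) q + vasyuninCotSum (q : ℤ) p) (P := Real.pi)
      (LJ := Real.log ((j : ℝ) + 1)) (LK := Real.log ((k : ℝ) + 1)) ha hb hq'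
    have e : nbGram j k = ((Real.log ((j : ℝ) + 1) - Real.log ((k : ℝ) + 1)) * ((k : ℝ) - j) / (2 * ((k : ℝ) + 1))
        + (Real.log (2 * Real.pi) - Real.eulerMascheroniConstant) * ((j : ℝ) + k + 2) / (2 * ((k : ℝ) + 1))
        - Real.pi * (vasyuninCotSum (p : ℤ) q + vasyuninCotSum (q : ℤ) p) / (2 * (q : ℝ))) / ((j : ℝ) + 1) := by
      rw [nbGram_eq_vasyunin j k, Real.log_div ha.ne' hb.ne']
      linear_combination halg
    have e2 : ((Real.log ((j : ℝ) + 1) - Real.log ((k : ℝ) + 1)) * ((k : ℝ) - j) / (2 * ((k : ℝ) + 1))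
        + (Real.log (2 * Real.pi) - Real.eulerMascheroniConstant) * ((j : ℝ) + k + 2) / (2 * ((k : ℝ) + 1))
        - Real.pi * (vasyuninCotSum (p : ℤ) q + vasyuninCotSum (q : ℤ) p) / (2 * (q : ℝ))) / ((j : ℝ) + 1) =
        ((Real.log ((j + 1 : ℕ) : ℝ) - Real.log ((k + 1 : ℕ) : ℝ)) * (((k : ℤ) - j : ℤ) : ℝ) / ((2 * (k + 1) : ℕ) : ℝ)
        + (Real.log (2 * Real.pi) - Real.eulerMascheroniConstant) * (((j : ℤ) + k + 2 : ℤ) : ℝ)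
            / ((2 * (k + 1) : ℕ) : ℝ)
        - Real.pi * (vasyuninCotSum (p : ℤ) q + vasyuninCotSum (q : ℤ) p) / ((2 * q : ℕ) : ℝ))
          / ((j + 1 : ℕ) : ℝ) := by
      push_cast
      ring
    rw [e, e2]; exact m4
  · simp at h

/-- Enclosure of `nbRhs k = (log(k+1) + 1 − γ)/(k+1)`. -/
def rhsEncl (S : ℕ) (L : List (Option MI)) (k : ℕ) : Option MI :=
  match lget L (k + 1) with
  | some LA => some (((LA.add (MI.ofInt S 1)).sub (gammaI S)).divNat (k + 1))
  | none => none

/-- `nbRhs k ∈ rhsEncl k`. -/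
theorem mem_rhsEncl {S M : ℕ} {L : List (Option MI)}
    (hL : ∀ n, n ≤ M → ∀ Y, lget L n = some Y → MI.mem S (Real.log n) Y) {k : ℕ} (hk : k < M) {Y : MI}
    (h : rhsEncl S L k = some Y) : MI.mem S (nbRhs k) Y := by
  unfold rhsEncl at h
  split at h
  · rename_i LA hLA
    simp only [Option.some.injEq] at h
    subst h
    have mA := hL (k + 1) (by omega) LA hLA
    have m := MI.mem_divNat (MI.mem_sub (MI.mem_add mA (MI.mem_ofInt S 1)) (mem_gammaI S)) (n := k + 1)
      (Nat.succ_pos k)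
    have e : nbRhs k = (Real.log ((k + 1 : ℕ) : ℝ) + ((1 : ℤ) : ℝ) - Real.eulerMascheroniConstant) / ((k + 1 : ℕ) : ℝ) := by
      rw [nbRhs_eq]; push_cast; ring
    rw [e]; exact m
  · simp at h

/-! ## The tables read by the certificate checker -/
/-- Upper triangle `j ≤ k < M` of the Gram enclosures (`none` below the diagonal; read through `gget`). -/
def gramTable (S M : ℕ) (T : List (List (Option MI))) (L : List (Option MI)) (c0 piI : MI) :
    List (List (Option MI)) :=
  (List.range M).map fun j ↦ (List.range M).map fun k ↦ if j ≤ k then gramEncl S T L c0 piI j k else none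

/-- Symmetric read-out of the Gram table. -/
def gget (G : List (List (Option MI))) (j k : ℕ) : Option MI := if j ≤ k then oget G j k else oget G k j

/-- The right-hand sides `k < M`. -/
def rhsTable (S M : ℕ) (L : List (Option MI)) : List (Option MI) := (List.range M).map fun k ↦ rhsEncl S L k

/-- Reading the Gram table. -/
theorem oget_gramTable {S M : ℕ} {T : List (List (Option MI))} {L : List (Option MI)} {c0 piI : MI}
    {j k : ℕ} (hj : j < M) (hk : k < M) :
    oget (gramTable S M T L c0 piI) j k = if j ≤ k then gramEncl S T L c0 piI j k else none := by
  simp only [oget, gramTable, List.getD_eq_getElem?_getD, List.getElem?_map, List.getElem?_range hj, List.getElem?_range hk,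
    Option.map_some, Option.getD_some]

/-- Reading the right-hand-side table. -/
theorem lget_rhsTable {S M : ℕ} {L : List (Option MI)} {k : ℕ} (hk : k < M) :
    lget (rhsTable S M L) k = rhsEncl S L k := by
  simp only [lget, rhsTable, List.getD_eq_getElem?_getD, List.getElem?_map, List.getElem?_range hk, Option.map_some,
    Option.getD_some]

/-- **Soundness of the Gram table**: with `piI ∋ π` and `c0 ∋ log 2π − γ`, every present entry of `gramTable` read
through `gget` encloses `nbGram j k` (`j, k < M`). -/
theorem mem_gget_gramTable {S KLOG KEXP KSQ M : ℕ} (hS : 0 < S) {piI c0 : MI} (hpi : MI.mem S Real.pi piI)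
    (hc0 : MI.mem S (Real.log (2 * Real.pi) - Real.eulerMascheroniConstant) c0) {j k : ℕ} (hj : j < M) (hk : k < M)
    {Y : MI} (hY : gget (gramTable S M (cotTable S KEXP KSQ M piI) (logTable S KLOG M) c0 piI) j k = some Y) :
    MI.mem S (nbGram j k) Y := by
  have hT : ∀ q, q ≤ M → ∀ r, 0 < r → r < q → ∀ c, oget (cotTable S KEXP KSQ M piI) q r = some c →
      MI.mem S (Real.cot ((r : ℝ) * Real.pi / q)) c :=
    fun q hq r hr hrq c hc ↦ mem_oget_cotTable hS hpi hq hr hrq hc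
  have hL : ∀ n, n ≤ M → ∀ Y, lget (logTable S KLOG M) n = some Y → MI.mem S (Real.log n) Y :=
    fun n hn Y hY ↦ mem_lget_logTable hS hn hY
  unfold gget at hY
  split_ifs at hY with hjk
  · rw [oget_gramTable hj hk, if_pos hjk] at hY
    exact mem_gramEncl hS hT hL hc0 hpi hj hk hY
  · rw [oget_gramTable hk hj, if_pos (by omega)] at hY
    rw [KappaZeroth.nbGram_comm]
    exact mem_gramEncl hS hT hL hc0 hpi hk hj hY

/-- **Soundness of the right-hand-side table**: every present entry `k < M` encloses `nbRhs k`. -/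
theorem mem_lget_rhsTable {S KLOG M : ℕ} (hS : 0 < S) {k : ℕ} (hk : k < M) {Y : MI}
    (hY : lget (rhsTable S M (logTable S KLOG M)) k = some Y) : MI.mem S (nbRhs k) Y := by
  rw [lget_rhsTable hk] at hY
  exact mem_rhsEncl (fun n hn Y hY ↦ mem_lget_logTable hS hn hY) hk hY

end NbKernel

end Summit.RiemannHypothesis.RiemannHypothesis.Theorems.NbTheory
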